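import Summits.CriticalPhenomena.PercolationContinuityZ3.Theorems.PercNearOneGluingNoHeavyLowerTailKnQuestion8CoefficientwiseCoreClassKernelMixCycleArcs
import HarnessLib

/-!
# Cluster traces on a bundle Θ(ℓ₁, …, ℓ_r) (towards IET(Θ) for thread-additive levels, layer 'glue')

Support file (`--supports stmt-CriticalPhenomena-4575`, closed), prover `prim-cplus-coupling` (gen 42).  No definitions, no notations, no named facts,
no sorries; standard axioms.  Memo `prim-cplus-coupling/A5-COUPLING-gen42.md` §6(a′), §7.

A BUNDLE is given explicitly, as in `iet_cycle`: `r` threads, thread `t < r` is the arc `w t 0 = u, w t 1, …, w t (L t) = b` with edges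
`ends (e t j) = s(w t (j−1), w t j)` (`1 ≤ j ≤ L t`), `w t` injective on `[0, L t]`, and two different threads meet only at the hubs.  For a colouring
`ω` (red edges) the memos use the TRACES of the red cluster `X = C_u(ω)` on the threads: if no thread is fully red then `X` is `u` together with the
LEADING RED RUNS, in particular `b ∉ X`; if some thread is fully red then `b ∈ X`.  This file proves exactly these facts (the blue cluster `Y = C_u(E∖ω)` is the
same statement for the complementary colouring):
* `bundle_prefix_mem_cluster` — every vertex of a leading red run lies in `C_u(ω)` (`arc_reach_fwd`);
* `bundle_cluster_subset_prefix` — if no thread is fully red, `C_u(ω) ⊆ {u} ∪ {leading red runs}` (closed-set argument);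
* `bundle_b_notMem_cluster_of_noFull`, `bundle_b_mem_cluster_of_full` — `b ∈ C_u(ω)` iff some thread is fully red (given no full thread / a full thread);
* `bundle_suffix_mem_cluster` — trailing red runs lie in `C_u(ω)` when `b ∈ C_u(ω)`;  `bundle_cluster_subset_runs` — for every `ω`, `C_u(ω) ⊆ {u, b} ∪ {leading red
  runs} ∪ {trailing red runs}` (the exact trace at supply points together with the two membership lemmas).
These are the thread-trace inputs of THEOREM LP1(Θ) (memo §7) whose abstract counting core is `fibre_flows_joins` (…KernelMixFibreFlowsJoins).
[cite: KozmaNitzan2024, Questions 8–9 (§5.5 p. 36) (context)]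
-/

namespace Summit.CriticalPhenomena.PercolationContinuityZ3.Theorems

open Finset Literature.Probability.Percolation

namespace Coefficientwise

variable {ι V : Type*}

open Classical in
/-- Leading red runs lie in the red cluster: if `e t 1, …, e t j ∈ ω` then `w t j ∈ C_u(ω)` (`w t 0 = u`). [folklore] -/
theorem bundle_prefix_mem_cluster (ends : ι → Sym2 V) (r : ℕ) (L : ℕ → ℕ) (w : ℕ → ℕ → V) (e : ℕ → ℕ → ι) (u : V)
    (hw0 : ∀ t, t < r → w t 0 = u)
    (harc : ∀ t, t < r → ∀ j, 1 ≤ j → j ≤ L t → ends (e t j) = s(w t (j - 1), w t j))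
    (ω : Finset ι) (t : ℕ) (ht : t < r) (j : ℕ) (hj : j ≤ L t) (hrun : ∀ j', 1 ≤ j' → j' ≤ j → e t j' ∈ ω) :
    w t j ∈ openCluster (ends '' (↑ω : Set ι)) u := by
  rw [← hw0 t ht]
  exact arc_reach_fwd ends (L t) (w t) (e t) (harc t ht) ω j hj hrun

open Classical in
/-- **Trace of the red cluster on a bundle without a fully red thread.**  If every thread has a blue edge, then `C_u(ω)` consists of `u` and the vertices
`w t j` (`1 ≤ j < L t`) whose whole initial segment `e t 1, …, e t j` is red.  (Closed-set argument: a red edge `e t j` with one end in this set has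
its other end in it, because threads meet only at the hubs and `b` is never reached.) [folklore] -/
theorem bundle_cluster_subset_prefix (ends : ι → Sym2 V) (r : ℕ) (L : ℕ → ℕ)
    (w : ℕ → ℕ → V) (e : ℕ → ℕ → ι) (u : V)
    (hw0 : ∀ t, t < r → w t 0 = u)
    (harc : ∀ t, t < r → ∀ j, 1 ≤ j → j ≤ L t → ends (e t j) = s(w t (j - 1), w t j))
    (hwinj : ∀ t, t < r → ∀ i j, i ≤ L t → j ≤ L t → w t i = w t j → i = j)
    (hcross : ∀ t t', t < r → t' < r → t ≠ t' → ∀ i j, i ≤ L t → j ≤ L t' → w t i = w t' j → (i = 0 ∧ j = 0) ∨ (i = L t ∧ j = L t'))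
    (E : Finset ι) (hE : ∀ i, i ∈ E → ∃ t, t < r ∧ ∃ j, 1 ≤ j ∧ j ≤ L t ∧ e t j = i)
    (ω : Finset ι) (hω : ω ⊆ E) (hnf : ∀ t, t < r → ∃ j, 1 ≤ j ∧ j ≤ L t ∧ e t j ∉ ω) :
    openCluster (ends '' (↑ω : Set ι)) u ⊆
      {x | x = u ∨ ∃ t, t < r ∧ ∃ j, 1 ≤ j ∧ j < L t ∧ x = w t j ∧ ∀ j', 1 ≤ j' → j' ≤ j → e t j' ∈ ω} := by
  set S : Set V := {x | x = u ∨ ∃ t, t < r ∧ ∃ j, 1 ≤ j ∧ j < L t ∧ x = w t j ∧ ∀ j', 1 ≤ j' → j' ≤ j → e t j' ∈ ω} with hS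
  refine openCluster_subset_of_closed ends ω u (S := S) (Or.inl rfl) ?_
  intro i hi a c hac haS
  obtain ⟨t, ht, j, hj1, hjL, rfl⟩ := hE i (hω hi)
  have he := harc t ht j hj1 hjL
  rw [he] at hac
  -- a vertex of thread t that lies in S is u or a leading-red-run vertex OF THREAD t
  have vert : ∀ j₀, j₀ ≤ L t → w t j₀ ∈ S → j₀ = 0 ∨ (1 ≤ j₀ ∧ j₀ < L t ∧ ∀ j', 1 ≤ j' → j' ≤ j₀ → e t j' ∈ ω) := by
    intro j₀ hj₀ hmem
    rcases hmem with h0 | ⟨t', ht', j', hj'1, hj'L, hEq, hpre⟩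
    · left
      exact hwinj t ht j₀ 0 hj₀ (Nat.zero_le _) (h0.trans (hw0 t ht).symm)
    · by_cases htt : t = t'
      · subst htt
        have := hwinj t ht j₀ j' hj₀ (le_of_lt hj'L) hEq
        subst this
        exact Or.inr ⟨hj'1, hj'L, hpre⟩
      · exfalso
        rcases hcross t t' ht ht' htt j₀ j' hj₀ (le_of_lt hj'L) hEq with ⟨_, h0⟩ | ⟨_, hL'⟩
        · omega
        · omega
  -- the whole initial segment up to j is red as soon as the one up to j-1 is (e t j ∈ ω is `hi`)
  have extend : (∀ j', 1 ≤ j' → j' ≤ j - 1 → e t j' ∈ ω) → ∀ j', 1 ≤ j' → j' ≤ j → e t j' ∈ ω := by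
    intro hpre j' h1 h2
    by_cases hj' : j' = j
    · rw [hj']; exact hi
    · exact hpre j' h1 (by omega)
  have notfull : ¬ (∀ j', 1 ≤ j' → j' ≤ L t → e t j' ∈ ω) := by
    intro hall
    obtain ⟨j'', h1, h2, hn⟩ := hnf t ht
    exact hn (hall j'' h1 h2)
  rcases Sym2.eq_iff.mp hac with ⟨ha, hc⟩ | ⟨ha, hc⟩
  · -- a = w t (j-1), c = w t j
    have hpre : ∀ j', 1 ≤ j' → j' ≤ j → e t j' ∈ ω := by
      rcases vert (j - 1) (by omega) (ha ▸ haS) with h0 | ⟨_, _, hp⟩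
      · exact extend (fun j' h1 h2 => by omega)
      · exact extend hp
    have hjlt : j < L t := by
      by_contra hge
      have hjeq : j = L t := le_antisymm hjL (not_lt.mp hge)
      exact notfull (fun j' h1 h2 => hpre j' h1 (hjeq ▸ h2))
    rw [← hc]
    exact Or.inr ⟨t, ht, j, hj1, hjlt, rfl, hpre⟩
  · -- a = w t j, c = w t (j-1)
    rcases vert j hjL (hc ▸ haS) with h0 | ⟨_, hjlt, hpre⟩
    · omega
    · rw [← ha]
      by_cases hj1' : j = 1
      · left; rw [hj1', Nat.sub_self]; exact hw0 t ht
      · exact Or.inr ⟨t, ht, j - 1, by omega, by omega, rfl, fun j' h1 h2 => hpre j' h1 (by omega)⟩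

open Classical in
/-- No fully red thread ⟹ `b ∉ C_u(ω)` on a bundle. [folklore] -/
theorem bundle_b_notMem_cluster_of_noFull (ends : ι → Sym2 V) (r : ℕ) (L : ℕ → ℕ) (hL : ∀ t, t < r → 1 ≤ L t)
    (w : ℕ → ℕ → V) (e : ℕ → ℕ → ι) (u b : V) (hr : 0 < r)
    (hw0 : ∀ t, t < r → w t 0 = u) (hwL : ∀ t, t < r → w t (L t) = b)
    (harc : ∀ t, t < r → ∀ j, 1 ≤ j → j ≤ L t → ends (e t j) = s(w t (j - 1), w t j))
    (hwinj : ∀ t, t < r → ∀ i j, i ≤ L t → j ≤ L t → w t i = w t j → i = j)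
    (hcross : ∀ t t', t < r → t' < r → t ≠ t' → ∀ i j, i ≤ L t → j ≤ L t' → w t i = w t' j → (i = 0 ∧ j = 0) ∨ (i = L t ∧ j = L t'))
    (E : Finset ι) (hE : ∀ i, i ∈ E → ∃ t, t < r ∧ ∃ j, 1 ≤ j ∧ j ≤ L t ∧ e t j = i)
    (ω : Finset ι) (hω : ω ⊆ E) (hnf : ∀ t, t < r → ∃ j, 1 ≤ j ∧ j ≤ L t ∧ e t j ∉ ω) :
    b ∉ openCluster (ends '' (↑ω : Set ι)) u := by
  intro hb
  have h := bundle_cluster_subset_prefix ends r L w e u hw0 harc hwinj hcross E hE ω hω hnf hb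
  rcases h with h0 | ⟨t, ht, j, hj1, hjL, hEq, _⟩
  · -- b = u contradicts injectivity on thread 0
    have := hwinj 0 hr (L 0) 0 (le_refl _) (Nat.zero_le _) ((hwL 0 hr).trans (h0.trans (hw0 0 hr).symm))
    have := hL 0 hr; omega
  · have := hwinj t ht (L t) j (le_refl _) (le_of_lt hjL) ((hwL t ht).trans hEq)
    omega

open Classical in
/-- A fully red thread puts `b` in the red cluster: if `e t 1, …, e t (L t) ∈ ω` then `b = w t (L t) ∈ C_u(ω)`. [folklore] -/
theorem bundle_b_mem_cluster_of_full (ends : ι → Sym2 V) (r : ℕ) (L : ℕ → ℕ) (w : ℕ → ℕ → V) (e : ℕ → ℕ → ι) (u b : V)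
    (hw0 : ∀ t, t < r → w t 0 = u) (hwL : ∀ t, t < r → w t (L t) = b)
    (harc : ∀ t, t < r → ∀ j, 1 ≤ j → j ≤ L t → ends (e t j) = s(w t (j - 1), w t j))
    (ω : Finset ι) (t : ℕ) (ht : t < r) (hfull : ∀ j', 1 ≤ j' → j' ≤ L t → e t j' ∈ ω) :
    b ∈ openCluster (ends '' (↑ω : Set ι)) u := by
  rw [← hwL t ht]
  exact bundle_prefix_mem_cluster ends r L w e u hw0 harc ω t ht (L t) (le_refl _) hfull

open Classical in
/-- Trailing red runs lie in the red cluster when `b` does: if `b ∈ C_u(ω)` and `e t (j+1), …, e t (L t) ∈ ω` then `w t j ∈ C_u(ω)` (`arc_reach_bwd` + transitivity).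
[folklore] -/
theorem bundle_suffix_mem_cluster (ends : ι → Sym2 V) (r : ℕ) (L : ℕ → ℕ) (w : ℕ → ℕ → V) (e : ℕ → ℕ → ι) (u b : V)
    (hwL : ∀ t, t < r → w t (L t) = b)
    (harc : ∀ t, t < r → ∀ j, 1 ≤ j → j ≤ L t → ends (e t j) = s(w t (j - 1), w t j))
    (ω : Finset ι) (hb : b ∈ openCluster (ends '' (↑ω : Set ι)) u)
    (t : ℕ) (ht : t < r) (j : ℕ) (hj : j ≤ L t) (hrun : ∀ j', j < j' → j' ≤ L t → e t j' ∈ ω) :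
    w t j ∈ openCluster (ends '' (↑ω : Set ι)) u := by
  have h1 : w t j ∈ openCluster (ends '' (↑ω : Set ι)) (w t (L t)) := arc_reach_bwd ends (L t) (w t) (e t) (harc t ht) ω j hj hrun
  rw [hwL t ht] at h1
  exact SimpleGraph.Reachable.trans hb h1

open Classical in
/-- **Trace of the red cluster on a bundle, general form.**  For EVERY colouring `ω ⊆ E`: `C_u(ω) ⊆ {u, b} ∪ {leading red runs} ∪ {trailing red runs}`, i.e. every
cluster vertex is a hub or a vertex `w t j` with `e t 1..e t j` all red or with `e t (j+1)..e t (L t)` all red.  (Closed-set argument as in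
`bundle_cluster_subset_prefix`; with `bundle_prefix_mem_cluster` / `bundle_suffix_mem_cluster` this is the exact trace when `b ∈ C_u(ω)`.) [folklore] -/
theorem bundle_cluster_subset_runs (ends : ι → Sym2 V) (r : ℕ) (L : ℕ → ℕ)
    (w : ℕ → ℕ → V) (e : ℕ → ℕ → ι) (u b : V)
    (hw0 : ∀ t, t < r → w t 0 = u) (hwL : ∀ t, t < r → w t (L t) = b)
    (harc : ∀ t, t < r → ∀ j, 1 ≤ j → j ≤ L t → ends (e t j) = s(w t (j - 1), w t j))
    (hwinj : ∀ t, t < r → ∀ i j, i ≤ L t → j ≤ L t → w t i = w t j → i = j)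
    (hcross : ∀ t t', t < r → t' < r → t ≠ t' → ∀ i j, i ≤ L t → j ≤ L t' → w t i = w t' j → (i = 0 ∧ j = 0) ∨ (i = L t ∧ j = L t'))
    (E : Finset ι) (hE : ∀ i, i ∈ E → ∃ t, t < r ∧ ∃ j, 1 ≤ j ∧ j ≤ L t ∧ e t j = i)
    (ω : Finset ι) (hω : ω ⊆ E) :
    openCluster (ends '' (↑ω : Set ι)) u ⊆
      {x | x = u ∨ x = b ∨ ∃ t, t < r ∧ ∃ j, 1 ≤ j ∧ j < L t ∧ x = w t j ∧
        ((∀ j', 1 ≤ j' → j' ≤ j → e t j' ∈ ω) ∨ (∀ j', j < j' → j' ≤ L t → e t j' ∈ ω))} := by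
  set S : Set V := {x | x = u ∨ x = b ∨ ∃ t, t < r ∧ ∃ j, 1 ≤ j ∧ j < L t ∧ x = w t j ∧
        ((∀ j', 1 ≤ j' → j' ≤ j → e t j' ∈ ω) ∨ (∀ j', j < j' → j' ≤ L t → e t j' ∈ ω))} with hS
  refine openCluster_subset_of_closed ends ω u (S := S) (Or.inl rfl) ?_
  intro i hi a c hac haS
  obtain ⟨t, ht, j, hj1, hjL, rfl⟩ := hE i (hω hi)
  have he := harc t ht j hj1 hjL
  rw [he] at hac
  -- membership of a thread-t vertex in S, read on thread t
  have vert : ∀ j₀, j₀ ≤ L t → w t j₀ ∈ S → j₀ = 0 ∨ j₀ = L t ∨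
      (1 ≤ j₀ ∧ j₀ < L t ∧ ((∀ j', 1 ≤ j' → j' ≤ j₀ → e t j' ∈ ω) ∨ (∀ j', j₀ < j' → j' ≤ L t → e t j' ∈ ω))) := by
    intro j₀ hj₀ hmem
    rcases hmem with h0 | hb | ⟨t', ht', j', hj'1, hj'L, hEq, hruns⟩
    · left; exact hwinj t ht j₀ 0 hj₀ (Nat.zero_le _) (h0.trans (hw0 t ht).symm)
    · right; left; exact hwinj t ht j₀ (L t) hj₀ (le_refl _) (hb.trans (hwL t ht).symm)
    · by_cases htt : t = t'
      · subst htt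
        have := hwinj t ht j₀ j' hj₀ (le_of_lt hj'L) hEq
        subst this
        exact Or.inr (Or.inr ⟨hj'1, hj'L, hruns⟩)
      · exfalso
        rcases hcross t t' ht ht' htt j₀ j' hj₀ (le_of_lt hj'L) hEq with ⟨_, h0⟩ | ⟨_, hL'⟩
        · omega
        · omega
  -- target membership helper: a thread-t vertex with a red run on one side is in S
  have put : ∀ j₀, j₀ ≤ L t → ((∀ j', 1 ≤ j' → j' ≤ j₀ → e t j' ∈ ω) ∨ (∀ j', j₀ < j' → j' ≤ L t → e t j' ∈ ω)) → w t j₀ ∈ S := by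
    intro j₀ hj₀ hruns
    by_cases h0 : j₀ = 0
    · left; rw [h0]; exact hw0 t ht
    by_cases hL' : j₀ = L t
    · right; left; rw [hL']; exact hwL t ht
    exact Or.inr (Or.inr ⟨t, ht, j₀, by omega, by omega, rfl, hruns⟩)
  rcases Sym2.eq_iff.mp hac with ⟨ha, hc⟩ | ⟨ha, hc⟩
  · -- a = w t (j-1), c = w t j
    rw [← hc]
    apply put j hjL
    rcases vert (j - 1) (by omega) (ha ▸ haS) with h0 | hLt | ⟨_, _, hruns⟩
    · left; intro j' h1 h2
      by_cases hj' : j' = j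
      · rw [hj']; exact hi
      · omega
    · omega
    · rcases hruns with hpre | hsuf
      · left; intro j' h1 h2
        by_cases hj' : j' = j
        · rw [hj']; exact hi
        · exact hpre j' h1 (by omega)
      · right; intro j' h1 h2; exact hsuf j' (by omega) h2
  · -- a = w t j, c = w t (j-1)
    rw [← ha]
    apply put (j - 1) (by omega)
    rcases vert j hjL (hc ▸ haS) with h0 | hLt | ⟨_, _, hruns⟩
    · omega
    · right; intro j' h1 h2
      by_cases hj' : j' = j
      · rw [hj']; exact hi
      · omega
    · rcases hruns with hpre | hsuf
      · left; intro j' h1 h2; exact hpre j' h1 (by omega)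
      · right; intro j' h1 h2
        by_cases hj' : j' = j
        · rw [hj']; exact hi
        · exact hsuf j' (by omega) h2

end Coefficientwise

end Summit.CriticalPhenomena.PercolationContinuityZ3.Theorems
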